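import Literature.Probability.Percolation.BoxCrossingCor62
import HarnessLib

/-!
# Box crossings of isoradial square lattices: real aspect ratios and real translations

Grimmett–Manolescu, *Bond percolation on isoradial graphs* (PTRF 159 (2014) 273–327 =
arXiv:1204.0505), §2.2 (Def. 2.2: the box-crossing property quantifies over all rectangles
`B(ρN, N)`, `ρ > 0` real, and all translates). The iteration of `BoxCrossingCor62` produces
bounds for index boxes of integer aspect ratio at integer positions; this file repackages them in
the exact form of the lower half of the tree's `BoxCrossingBounds` for the drawing `zDia`:
real aspect ratio `ρ > 0`, box sizes `ρn × n` / `n × ρn`, arbitrary translation `w ∈ ℂ`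
(`realBoxes_of_bounds`; clipping an integer-box crossing at the integer levels next to the sides).

## References

* G. R. Grimmett, I. Manolescu, PTRF 159 (2014), arXiv:1204.0505, §2.2 (Def. 2.2), §6.2 (Cor. 6.2).
-/

noncomputable section

namespace Literature.Probability.Percolation

open LatticeModels StarTriangle Real MeasureTheory Complex

namespace TrackExchange

/-- Real and imaginary parts of `zDia v - w`. [folklore] -/
theorem re_zDia_sub (v : Site 2) (w : ℂ) : (zDia v - w).re = col v - w.re := by simp [zDia]

/-- Real and imaginary parts of `zDia v - w`. [folklore] -/
theorem im_zDia_sub (v : Site 2) (w : ℂ) : (zDia v - w).im = hgtOf v - w.im := by simp [zDia]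

/-- **An integer-box left–right crossing gives the real-box one**: if `[A, A + a'] ⊇ [⌊re w⌋, ⌈re w + a⌉]`
and `[B, B + b'] ⊆ [im w, im w + b]`, then (lattice configurations)
`lrEvt A B a' b' ⊆ embRectCrossing (zDia - w) a b`. [folklore] -/
theorem embRectCrossing_of_lrEvt {w : ℂ} {a b : ℝ} {A B : ℤ} {a' b' : ℕ} (ha : 0 ≤ a)
    (hA : A ≤ ⌊w.re⌋) (hA' : ⌈w.re + a⌉ ≤ A + a') (hB : w.im ≤ B) (hB' : (B : ℝ) + b' ≤ w.im + b)
    {ω : Set (Sym2 (Site 2))} (hω : ω ⊆ (zdGraph 2).edgeSet) (h : ω ∈ lrEvt A B a' b') :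
    ω ∈ embRectCrossing (fun v => zDia v - w) a b := by
  rw [mem_lrEvt_iff] at h
  obtain ⟨x, hx, y, hy, hconn⟩ := h
  have ix : col x ≤ ⌊w.re⌋ := le_trans (by exact_mod_cast hx) hA
  have iy : ⌈w.re + a⌉ ≤ col y := le_trans hA' (by exact_mod_cast hy)
  have hle : ⌊w.re⌋ ≤ ⌈w.re + a⌉ := by
    have : (⌊w.re⌋ : ℝ) ≤ ⌈w.re + a⌉ := (Int.floor_le _).trans ((le_add_of_nonneg_right ha).trans (Int.le_ceil _))
    exact_mod_cast this
  obtain ⟨x', y', hx', hy', hconn'⟩ := exists_openConnIn_clip hω col col_le_of_adj hle ix iy hconn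
  refine ⟨x', ?_, y', ?_, openConnIn_mono (fun v hv => ?_) _ _ hconn'⟩
  · simp only [Set.mem_setOf_eq, re_zDia_sub, hx', sub_nonpos]; exact Int.floor_le _
  · simp only [Set.mem_setOf_eq, re_zDia_sub, hy']; linarith [Int.le_ceil (w.re + a)]
  · obtain ⟨⟨-, h3, h4⟩, h5, h6⟩ := hv
    simp only [Set.mem_setOf_eq, re_zDia_sub, im_zDia_sub, Set.mem_Icc]
    have i5 : (⌊w.re⌋ : ℝ) ≤ col v := by exact_mod_cast h5
    have i6 : (col v : ℝ) ≤ ⌈w.re + a⌉ := by exact_mod_cast h6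
    refine ⟨⟨?_, ?_⟩, by linarith, by linarith⟩
    · linarith [Int.lt_floor_add_one w.re]
    · linarith [Int.ceil_lt_add_one (w.re + a)]

/-- **An integer-box top–bottom crossing gives the real-box one.** [folklore] -/
theorem embTBCrossing_of_tbEvt {w : ℂ} {a b : ℝ} {A B : ℤ} {a' b' : ℕ} (hb : 0 ≤ b)
    (hB : B ≤ ⌊w.im⌋) (hB' : ⌈w.im + b⌉ ≤ B + b') (hA : w.re ≤ A) (hA' : (A : ℝ) + a' ≤ w.re + a)
    {ω : Set (Sym2 (Site 2))} (hω : ω ⊆ (zdGraph 2).edgeSet) (h : ω ∈ tbEvt A B a' b') :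
    ω ∈ embTBCrossing (fun v => zDia v - w) a b := by
  rw [mem_tbEvt_iff] at h
  obtain ⟨x, hx, y, hy, hconn⟩ := h
  have ix : hgtOf x ≤ ⌊w.im⌋ := le_trans (by exact_mod_cast hx) hB
  have iy : ⌈w.im + b⌉ ≤ hgtOf y := le_trans hB' (by exact_mod_cast hy)
  have hle : ⌊w.im⌋ ≤ ⌈w.im + b⌉ := by
    have : (⌊w.im⌋ : ℝ) ≤ ⌈w.im + b⌉ := (Int.floor_le _).trans ((le_add_of_nonneg_right hb).trans (Int.le_ceil _))
    exact_mod_cast this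
  obtain ⟨x', y', hx', hy', hconn'⟩ := exists_openConnIn_clip hω hgtOf hgtOf_le_of_adj hle ix iy hconn
  refine ⟨x', ?_, y', ?_, openConnIn_mono (fun v hv => ?_) _ _ hconn'⟩
  · simp only [Set.mem_setOf_eq, im_zDia_sub, hx', sub_nonpos]; exact Int.floor_le _
  · simp only [Set.mem_setOf_eq, im_zDia_sub, hy']; linarith [Int.le_ceil (w.im + b)]
  · obtain ⟨⟨⟨h3, h4⟩, -, -⟩, h5, h6⟩ := hv
    simp only [Set.mem_setOf_eq, re_zDia_sub, im_zDia_sub, Set.mem_Icc]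
    have i5 : (⌊w.im⌋ : ℝ) ≤ hgtOf v := by exact_mod_cast h5
    have i6 : (hgtOf v : ℝ) ≤ ⌈w.im + b⌉ := by exact_mod_cast h6
    refine ⟨⟨by linarith, by linarith⟩, ?_, ?_⟩
    · linarith [Int.lt_floor_add_one w.im]
    · linarith [Int.ceil_lt_add_one (w.im + b)]

/-- **Real aspect ratios and translations from the integer bounds.** If a class has uniform lower
bounds for left–right crossings of `ρn × n` and top–bottom crossings of `n × ρn` index boxes for
every integer `ρ ≥ 1`, then for every real `ρ > 0` it has uniform lower bounds for the crossings of
the boxes `B(ρn, n)` / `B(n, ρn)` at every translate `w ∈ ℂ` — the lower half of the tree's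
`BoxCrossingBounds` for the drawing `zDia`. [cite: GrimmettManolescu2014Isoradial, §2.2 Def. 2.2] -/
theorem realBoxes_of_bounds {C : Set ((ℤ → ℝ) × (ℤ → ℝ))} (hH : ∀ ρ : ℕ, 1 ≤ ρ → (lrLower C ρ).Nonempty)
    (hV : ∀ ρ : ℕ, 1 ≤ ρ → (tbLower C ρ).Nonempty) {ρ : ℝ} (hρ : 0 < ρ) :
    ∃ c > (0 : ℝ), ∃ n₀ : ℕ, ∀ p ∈ C, ∀ n : ℕ, n₀ ≤ n → ∀ w : ℂ,
      c ≤ (Pgm p.1 p.2).real (embRectCrossing (fun v => zDia v - w) (ρ * n) n) ∧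
      c ≤ (Pgm p.1 p.2).real (embTBCrossing (fun v => zDia v - w) n (ρ * n)) := by
  -- integer aspect ratio `R = ⌈ρ⌉ + 4` at scale `m = n / 2 ≥ R`
  set R : ℕ := ⌈ρ⌉₊ + 4 with hR
  obtain ⟨⟨cH, nH⟩, hcH, hHb⟩ := hH (2 * R) (by omega)
  obtain ⟨⟨cV, nV⟩, hcV, hVb⟩ := hV (2 * R) (by omega)
  simp only at hcH hHb hcV hVb
  refine ⟨min cH cV, lt_min hcH hcV, 2 * (max (max nH nV) R) + 2, fun p hp n hn w => ?_⟩
  have rR : (R : ℝ) = ⌈ρ⌉₊ + 4 := by rw [hR]; push_cast; ring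
  have rρ : ρ ≤ R - 4 := by rw [rR]; linarith [Nat.le_ceil ρ]
  -- the scale `m = n / 2`
  set m : ℕ := n / 2 with hm
  have hm1 : 2 * m ≤ n := by omega
  have hm2 : n < 2 * m + 2 := by omega
  have hmH : nH ≤ m := by omega
  have hmV : nV ≤ m := by omega
  have hmR : R ≤ m := by omega
  have rn : (n : ℝ) < 2 * m + 2 := by exact_mod_cast hm2
  have rm1 : (2 * m : ℝ) ≤ n := by exact_mod_cast hm1
  have rmR : (R : ℝ) ≤ m := by exact_mod_cast hmR
  have hR4 : (4 : ℝ) ≤ R := by rw [rR]; linarith [(Nat.cast_nonneg ⌈ρ⌉₊ : (0 : ℝ) ≤ ⌈ρ⌉₊)]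
  have h3 : ρ * n ≤ (R - 4 : ℝ) * (2 * m + 2) := by nlinarith
  have h4 : (R - 4 : ℝ) * (2 * m + 2) + 2 ≤ 2 * R * m := by nlinarith
  have key : ∀ t : ℝ, (⌈t + ρ * n⌉ : ℝ) ≤ ⌊t⌋ + ((2 * R * m : ℕ) : ℝ) := by
    intro t
    have h1 : (⌈t + ρ * n⌉ : ℝ) < t + ρ * n + 1 := Int.ceil_lt_add_one _
    have h2 : t < ⌊t⌋ + 1 := Int.lt_floor_add_one _
    push_cast; linarith
  have key' : ∀ t : ℝ, ⌈t + ρ * n⌉ ≤ ⌊t⌋ + ((2 * R * m : ℕ) : ℤ) := fun t => by exact_mod_cast key t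
  have side : ∀ t : ℝ, (⌈t⌉ : ℝ) + (m : ℕ) ≤ t + n := by
    intro t
    have : (⌈t⌉ : ℝ) < t + 1 := Int.ceil_lt_add_one _
    have : (1 : ℝ) + m ≤ n := by linarith [(show (4 : ℝ) ≤ m from hR4.trans rmR)]
    linarith
  constructor
  · -- left–right
    refine (min_le_left _ _).trans ((hHb p hp m hmH ⌊w.re⌋ ⌈w.im⌉).trans ?_)
    exact measureReal_le_of_subset_ae p.1 p.2 fun ω hω h =>
      embRectCrossing_of_lrEvt (by positivity) le_rfl (key' w.re) (Int.le_ceil _) (side w.im) hω h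
  · -- top–bottom
    refine (min_le_right _ _).trans ((hVb p hp m hmV ⌈w.re⌉ ⌊w.im⌋).trans ?_)
    exact measureReal_le_of_subset_ae p.1 p.2 fun ω hω h =>
      embTBCrossing_of_tbEvt (by positivity) le_rfl (key' w.im) (Int.le_ceil _) (side w.re) hω h

end TrackExchange

end Literature.Probability.Percolation
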